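import Literature.Computability.MetaComplexity.GapMINKT
import HarnessLib

/-!
# Complexity meta: `r`-random strings, `MINKT[r]`, the ensemble `𝒟^KT`, and Hirahara's dense-subset lemma

Topic `Literature/Computability/MetaComplexity`. Second layer of the decomposition of the named fact
`Hirahara2018_gapMINKT_mem_PromiseP` (`GapMINKT.lean`; Hirahara, FOCS 2018 / ECCC TR18-138 rev. 1,
Cor. 4.23), below `Hirahara2018_gapMINKT_mem_PromiseZPP` (`GapMINKTAverageCase.lean`, Cor. 4.22
(1 ⇒ 4)): the *average-case hypothesis side* of Thm. 4.21, i.e. §4.3 of the full version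
("a dense `r`-random string can be accepted by some polynomial-time machine if `DistNP ⊆ AvgP`").

Definitions (real, with bodies), for a clocked universal machine `U : UniversalMachine`:

* `U.randomStrings t r = R_t[r] = {x | K^t(x) ≥ r(|x|)}` — the `r`-random strings w.r.t. `K^t`
  (Def. 4.1);
* `IsDense m δ A` — `Pr_{w ∈ {0,1}^m}[w ∈ A] ≥ δ` (Def. 4.2, via the tree's `uniformProb`);
* `U.MINKTr r = MINKT[r] = {(x, 1^t) | K^t(x) < r(|x|)}` (Def. 4.14), instances encoded by
  `paramEnc (x, t) = boolPair x (unaryEncodeNat t)` (`DistProblems.lean`);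
* `DKT = 𝒟^KT`, the "uniform distribution with auxiliary unary input" (Def. 4.13): `𝒟^KT_m` picks
  `n ∈_R [m]` and `x ∈_R {0,1}^n` and outputs `(x, 1^{m-n})` — an `Ensemble` (`ℕ → PMF (List Bool)`).

Named facts (statements only, `def … : Prop`, D-0014):

* `Hirahara2018_MINKTr_mem_NP` — `MINKT[r] ∈ NP` for efficiently computable `r` (Fact 4.15, the
  `NP` half);
* `Hirahara2018_dense_randomStrings_of_AvgDeltaP` — **Lemma 4.17**: if `r(n) < n` for all large `n` and
  `(MINKT[r], 𝒟^KT) ∈ Avg_{1/6m}P`, then some `T ∈ P` has `T_t^{=n}` a `1/3`-dense subset of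
  `R_t[r]` for all large `n` and every `t`;
* `Hirahara2018_MINKTr_DKT_mem_AvgDeltaP` — **Cor. 4.22 (1 ⇒ 2)**: if `DistNP ⊆ AvgP` then
  `(MINKT[n-1], 𝒟^KT) ∈ Avg_{1/6m}P`.

## Design choices and faithfulness

* `R_t[r]` contains every `x` with `K^t(x) = ⊤` (no program prints `x` within `t` steps), the
  `min ∅ = +∞` reading of Def. 3.2, as everywhere in `UniversalMachine.lean` (`ℕ∞`-valued `K^t`).
* `MINKT[r]` consists of WELL-FORMED instances `paramEnc (x, t)` only (as `U.MINKT`); membership of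
  a well-formed instance is `K^t(x) < r(|x|)` (`paramEnc_mem_MINKTr_iff`).
* `𝒟^KT_m` for `m = 0` (`[0] = ∅`, not covered in print) is the point mass on the empty instance
  `paramEnc ([], 0)` — a documented junk value; it only adds the (satisfiable) parameter-`0`
  clause to `Avg_δP` hypotheses/conclusions below.
* **Samplability.** Hirahara's "`𝒟^KT` is efficiently samplable" (before Def. 4.14) and Fact 4.15
  `(MINKT[r], 𝒟^KT) ∈ DistNP` are NOT vendored: the tree's `PSamp` (`Ensemble.IsPolySamplable`,
  `DistProblems.lean`) asks for an EXACT sampler with a polynomial coin budget, whose output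
  probabilities are dyadic, while `𝒟^KT_m` has point masses `2^{-n}/m`. Lemma 4.17 is therefore
  vendored verbatim with its printed hypothesis `(MINKT[r], 𝒟^KT) ∈ Avg_{1/6m}P` (the tree's
  `AvgDeltaP`, Bogdanov–Trevisan's `Avg_δP`, with the instance `(x,1^t)` and the parameter `1^m`),
  and Cor. 4.22 (1 ⇒ 2) verbatim as the implication `DistNP ⊆ AvgP → (MINKT[n-1], 𝒟^KT) ∈
  Avg_{1/6m}P`. The latter remains true under the tree's conventions, but not by the printed
  one-liner "`(MINKT[r], 𝒟^KT) ∈ DistNP ⊆ AvgP ⊆ Avg_{1/6m}P`": one applies `DistNP ⊆ AvgP` to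
  `MINKT[n-1]` paired with an exactly samplable ensemble with the same supports that dominates
  `𝒟^KT` within a factor `2` (choose `n-1 := j mod m` for `j ∈_R [2^{⌈log₂ m⌉}]`), and runs the
  errorless scheme with error parameter `12(m+1)`; errorlessness is support-relative in both
  classes (`IsErrorlessFor`), and the supports agree.
* Hirahara's `Avg_δP` (Def. 4.16) asks errorlessness on every input, the tree's `AvgDeltaP` on
  `supp 𝒟_m` only (Bogdanov–Trevisan, Def. 2.4); for `𝒟^KT` every well-formed instance
  `(x, 1^t)` with `|x| ≥ 1` lies in `supp 𝒟^KT_{|x|+t}`, which is all the proof of Lemma 4.17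
  uses (Claim 4.18 conditions on `|x| = n` inside `𝒟^KT_{n+t}`).

## References

* S. Hirahara, *Non-black-box worst-case to average-case reductions within NP*, FOCS 2018; full
  version ECCC TR18-138 rev. 1 (2019): Defs. 4.1, 4.2, 4.13, 4.14, Fact 4.15, Def. 4.16,
  Lemma 4.17 with Claim 4.18, Cor. 4.22 [Hirahara2018] (text checked: ECCC revision 1 PDF).
* S. Hirahara, *Non-disjoint promise problems from meta-computational view of pseudorandom
  generator constructions*, Theory of Computing 19(4) (2023), Lemma 3.5 (the same lemma for
  `r(n) = n - 1`, density `1/4`, every `n`).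
* A. Bogdanov, L. Trevisan, *Average-case complexity*, FnT-TCS 2 (2006), Def. 2.4, Def. 2.7
  (`Avg_δP`) [BogdanovTrevisan2006].
-/

namespace Literature.Computability.MetaComplexity

open _root_.Computability Complexity

/-! ### `r`-random strings and density (Defs. 4.1, 4.2) -/

namespace UniversalMachine

variable (U : UniversalMachine)

/-- **`R_t[r]`**, the `r`-random strings with respect to `K^t` (Def. 4.1): `x` is `r`-random if
`K^t(x) ≥ r(|x|)` (in `ℕ∞`; a string that no program prints within `t` steps is `r`-random).
[cite: Hirahara2018, Def. 4.1] -/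
def randomStrings (t : ℕ) (r : ℕ → ℕ) : Set (List Bool) :=
  {x | (r x.length : ℕ∞) ≤ U.ktAt t x}

/-- Membership in `R_t[r]` unfolds definitionally. [cite: Hirahara2018, Def. 4.1] -/
theorem mem_randomStrings_iff {t : ℕ} {r : ℕ → ℕ} {x : List Bool} :
    x ∈ U.randomStrings t r ↔ (r x.length : ℕ∞) ≤ U.ktAt t x :=
  Iff.rfl

/-- `R_t[r]` is antitone in the time bound (`K^{t'} ≤ K^t` for `t ≤ t'`, `ktAt_anti`) and in the
threshold `r`. [cite: Hirahara2018, Def. 4.1] -/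
theorem randomStrings_anti {t t' : ℕ} (ht : t ≤ t') {r r' : ℕ → ℕ} (hr : ∀ n, r n ≤ r' n) :
    U.randomStrings t' r' ⊆ U.randomStrings t r := fun x hx =>
  calc (r x.length : ℕ∞) ≤ r' x.length := by exact_mod_cast hr _
    _ ≤ U.ktAt t' x := hx
    _ ≤ U.ktAt t x := U.ktAt_anti ht x

/-- **`MINKT[r]`** (Def. 4.14): the language `{(x, 1^t) | K^t(x) < r(|x|)}` of `r`-nonrandom
instances, encoded by `paramEnc (x, t) = boolPair x (unaryEncodeNat t)` (well-formed instances
only, as for `U.MINKT`). [cite: Hirahara2018, Def. 4.14] -/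
def MINKTr (r : ℕ → ℕ) : Language Bool :=
  {w | ∃ (x : List Bool) (t : ℕ), w = paramEnc (x, t) ∧ U.ktAt t x < r x.length}

/-- A well-formed instance `(x, 1^t)` lies in `MINKT[r]` iff `K^t(x) < r(|x|)` (injectivity of
`boolPair` and `unaryEncodeNat`). [cite: Hirahara2018, Def. 4.14] -/
theorem paramEnc_mem_MINKTr_iff {r : ℕ → ℕ} {x : List Bool} {t : ℕ} :
    paramEnc (x, t) ∈ U.MINKTr r ↔ U.ktAt t x < r x.length := by
  constructor
  · rintro ⟨x', t', h, hk⟩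
    have h1 := boolPair_injective (a₁ := (x, _)) (a₂ := (x', _)) h
    simp only [Prod.mk.injEq] at h1
    obtain ⟨rfl, h2⟩ := h1
    have ht : t = t' := by simpa using congr_arg unaryDecodeNat h2
    subst ht
    exact hk
  · exact fun h => ⟨x, t, rfl, h⟩

/-- `(x, 1^t) ∈ MINKT[r]` iff `x` is NOT `r`-random w.r.t. `K^t` (Def. 4.14: "deciding whether `x`
is `r`-nonrandom"). [cite: Hirahara2018, Def. 4.14] -/
theorem paramEnc_mem_MINKTr_iff_not_mem_randomStrings {r : ℕ → ℕ} {x : List Bool} {t : ℕ} :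
    paramEnc (x, t) ∈ U.MINKTr r ↔ x ∉ U.randomStrings t r := by
  rw [paramEnc_mem_MINKTr_iff, mem_randomStrings_iff, not_le]

end UniversalMachine

/-- **`δ`-dense** (Def. 4.2): a set of strings is `δ`-dense at length `m` if a uniformly random
string of length `m` lies in it with probability `≥ δ` (`uniformProb`, `Randomized.lean`); Hirahara
states it for `A ⊆ {0,1}^m`, here only the length-`m` strings of `A` are counted.
[cite: Hirahara2018, Def. 4.2] -/
def IsDense (m : ℕ) (δ : ℝ) (A : Set (List Bool)) : Prop :=
  δ ≤ uniformProb m A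

/-- Density is monotone in the set and antitone in `δ`. [cite: Hirahara2018, Def. 4.2] -/
theorem IsDense.mono {m : ℕ} {δ δ' : ℝ} {A B : Set (List Bool)} (h : IsDense m δ A) (hδ : δ' ≤ δ)
    (hAB : A ⊆ B) : IsDense m δ' B := by
  unfold IsDense at h ⊢
  refine hδ.trans (h.trans ?_)
  classical
  unfold uniformProb
  refine div_le_div_of_nonneg_right ?_ (by positivity)
  exact_mod_cast Finset.card_le_card fun r hr => by
    simp only [Finset.mem_filter, Finset.mem_univ, true_and] at hr ⊢
    exact hAB hr

/-! ### The ensemble `𝒟^KT` (Def. 4.13) -/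

/-- **`𝒟^KT`**, the uniform distribution with auxiliary unary input (Def. 4.13): for `m ≥ 1`,
`𝒟^KT_m` is the output distribution of "pick `n ∈_R [m]` and `x ∈_R {0,1}^n`, output
`(x, 1^{m-n})`" (encoded by `paramEnc`; `n = i + 1` for `i : Fin m`, `x` from the tree's
`uniformEnsemble`). For `m = 0` (not covered in print, `[0] = ∅`) it is the point mass on the empty
instance `paramEnc ([], 0)` — a documented junk value. [cite: Hirahara2018, Def. 4.13] -/
noncomputable def DKT : Ensemble := fun m =>
  if h : m = 0 then PMF.pure (paramEnc ([], 0))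
  else
    haveI : NeZero m := ⟨h⟩
    (PMF.uniformOfFintype (Fin m)).bind fun i =>
      (uniformEnsemble (i.1 + 1)).map fun x => paramEnc (x, m - (i.1 + 1))

/-- The support of `𝒟^KT_m`, `m ≥ 1`: exactly the instances `(x, 1^{m-|x|})` with `1 ≤ |x| ≤ m`.
[cite: Hirahara2018, Def. 4.13] -/
theorem mem_support_DKT_iff {m : ℕ} (hm : m ≠ 0) (w : List Bool) :
    w ∈ (DKT m).support ↔
      ∃ x : List Bool, 1 ≤ x.length ∧ x.length ≤ m ∧ w = paramEnc (x, m - x.length) := by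
  unfold DKT
  rw [dif_neg hm]
  haveI : NeZero m := ⟨hm⟩
  simp only [PMF.mem_support_bind_iff, PMF.mem_support_map_iff, mem_support_uniformEnsemble_iff]
  constructor
  · rintro ⟨i, -, x, hx, rfl⟩
    refine ⟨x, by omega, by omega, ?_⟩
    rw [hx]
  · rintro ⟨x, h1, h2, rfl⟩
    refine ⟨⟨x.length - 1, by omega⟩, PMF.mem_support_uniformOfFintype _, x, ?_, ?_⟩
    · change x.length = x.length - 1 + 1
      omega
    · change paramEnc (x, m - (x.length - 1 + 1)) = paramEnc (x, m - x.length)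
      congr 2
      omega

/-- In particular every well-formed instance `(x, 1^t)` with `x ≠ []` is in the support of
`𝒟^KT_{|x|+t}` — the only way the support-relative errorlessness of the tree's `AvgDeltaP` enters
the proof of Lemma 4.17 (Claim 4.18). [cite: Hirahara2018, Claim 4.18] -/
theorem paramEnc_mem_support_DKT {x : List Bool} (hx : x ≠ []) (t : ℕ) :
    paramEnc (x, t) ∈ (DKT (x.length + t)).support := by
  have h1 : 1 ≤ x.length := Nat.one_le_iff_ne_zero.2 fun h => hx (List.eq_nil_of_length_eq_zero h)
  rw [mem_support_DKT_iff (by omega)]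
  exact ⟨x, h1, by omega, by congr 2; omega⟩

/-! ### Named facts: Fact 4.15 (`NP` half), Lemma 4.17, Cor. 4.22 (1 ⇒ 2) -/

/-- **Hirahara 2018, Fact 4.15 (`NP` half).** *`MINKT[r] ∈ NP` if `r : ℕ → ℕ` is efficiently
computable* ("It is easy to see that `MINKT[r] ∈ NP`": guess a program `d` of length `< r(|x|)`
and run the universal machine for `t` steps, polynomial in `|(x, 1^t)|` by `U.polyTime`).
"Efficiently computable" is rendered as polynomial-time computability of `r` with unary input and
output (`PolyTimeComputable unaryEncodeNat unaryEncodeNat r`, which forces `r(n) ≤ poly(n)`; it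
holds for `r(n) = n - 1`). The `DistNP` half of Fact 4.15 is not vendored (module docstring,
"Samplability"). [cite: Hirahara2018, Fact 4.15] -/
def Hirahara2018_MINKTr_mem_NP : Prop :=
  ∀ (U : UniversalMachine) (r : ℕ → ℕ),
    PolyTimeComputable unaryEncodeNat unaryEncodeNat r → U.MINKTr r ∈ Nondeterministic.NP

/-- **Hirahara 2018, Lemma 4.17** (a dense subset of random strings in `P` from an errorless
heuristic algorithm). *Let `r : ℕ → ℕ` be any function such that `r(n) < n` for all large `n`. If
`(MINKT[r], 𝒟^KT) ∈ Avg_δP` for `δ(m) := 1/6m`, then there exists a language `T ∈ P` such that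
`T_t^{=n}` is a `1/3`-dense subset of `R_t[r]`, for all large `n ∈ ℕ` and every `t ∈ ℕ`* — where
`T_t := {x | (x, 1^t) ∈ T}` and `T_t^{=n}` its length-`n` slice. `Avg_δP` is the tree's
`AvgDeltaP` (the algorithm reads `⟨(x,1^t), 1^m⟩`, is errorless on `supp 𝒟^KT_m` and fails with
probability `≤ δ(m)` under `𝒟^KT_m`; at the junk parameter `m = 0`, `δ(0) = 1/0 = 0` only adds a
satisfiable clause to the hypothesis). In print: `T(x,1^t) := [M(x,1^t) = 0]`; errorlessness puts
`T_t` inside `R_t[r]`; Claim 4.18 (conditioning `𝒟^KT_{n+t}` on `|x| = n` costs a factor `m`) and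
the count `#{x ∈ {0,1}^n | K^t(x) < r(n)} < 2^{r(n)} ≤ 2^n/2` (`ncard_setOf_ktAt_lt`) give density
`1 - 1/6 - 1/2 = 1/3`. [cite: Hirahara2018, Lemma 4.17] -/
def Hirahara2018_dense_randomStrings_of_AvgDeltaP : Prop :=
  ∀ (U : UniversalMachine) (r : ℕ → ℕ), (∃ n₀, ∀ n ≥ n₀, r n < n) →
    (⟨U.MINKTr r, DKT⟩ : DistProblem) ∈ AvgDeltaP (fun m => 1 / (6 * m)) →
      ∃ T ∈ Classes.P, ∃ n₀ : ℕ, ∀ n ≥ n₀, ∀ t : ℕ,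
        {x | x.length = n ∧ paramEnc (x, t) ∈ T} ⊆ U.randomStrings t r ∧
        IsDense n (1 / 3) {x | paramEnc (x, t) ∈ T}

/-- **Hirahara 2018, Corollary 4.22 (1 ⇒ 2).** *If `DistNP ⊆ AvgP` then
`(MINKT[r], 𝒟^KT) ∈ Avg_{1/6m}P` for `r(n) := n - 1`.* In print this is the one-liner
"`(MINKT[r], 𝒟^KT) ∈ DistNP ⊆ AvgP ⊆ Avg_{1/6m}P`" (Fact 4.15 and Def. 4.16); under the tree's
exact samplers `𝒟^KT ∉ PSamp` verbatim and the implication goes through an exactly samplable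
ensemble with the same supports dominating `𝒟^KT` within a factor `2` (module docstring,
"Samplability") — the STATEMENT is the printed one. (`n - 1` is truncated subtraction, `r(0) = 0`,
immaterial: no `x` has `K^t(x) < 0`.) [cite: Hirahara2018, Cor. 4.22] -/
def Hirahara2018_MINKTr_DKT_mem_AvgDeltaP : Prop :=
  ∀ U : UniversalMachine, DistNP ⊆ AvgP →
    (⟨U.MINKTr fun n => n - 1, DKT⟩ : DistProblem) ∈ AvgDeltaP (fun m => 1 / (6 * m))

/-- The two facts compose to the input of Thm. 4.21's proof under `DistNP ⊆ AvgP`: a language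
`T ∈ P` whose slices `T_t^{=n}` are `1/3`-dense subsets of the `(n-1)`-random strings `R_t[n-1]`
for all large `n` and every `t` ("By Lemma 4.17, there exists a language `T` in `P` such that …",
first paragraph of the proof of Thm. 4.21, with `r(n) = n - 1` from Cor. 4.22 (1 ⇒ 2)).
[cite: Hirahara2018, Thm. 4.21 (proof, ¶1)] -/
theorem exists_dense_randomStrings_mem_P_of_DistNP (h₁ : Hirahara2018_MINKTr_DKT_mem_AvgDeltaP)
    (h₂ : Hirahara2018_dense_randomStrings_of_AvgDeltaP) (U : UniversalMachine) (hD : DistNP ⊆ AvgP) :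
    ∃ T ∈ Classes.P, ∃ n₀ : ℕ, ∀ n ≥ n₀, ∀ t : ℕ,
      {x | x.length = n ∧ paramEnc (x, t) ∈ T} ⊆ U.randomStrings t (fun n => n - 1) ∧
      IsDense n (1 / 3) {x | paramEnc (x, t) ∈ T} :=
  h₂ U (fun n => n - 1) ⟨2, fun n hn => by omega⟩ (h₁ U hD)

end Literature.Computability.MetaComplexity
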